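import Literature.NumberTheory.Transcendental.Analytification
import Mathlib.Geometry.Manifold.MFDeriv.Basic
import HarnessLib

/-!
# Analytification: regular functions on arbitrary opens are holomorphic (proof file)

Sibling proof file of `Literature/NumberTheory/Transcendental/Analytification.lean`. That file
defines the predicate `Literature.IsAnalytification E X d φ` (a map `φ : M → X(ℂ)` exhibiting the complex
charted space `M` as the analytification `X^an` of the `k`-scheme `X`, `k ⊆ ℂ`), whose field
`mdifferentiableOn_evalOrZero` asks that regular functions on *affine* opens pull back along `φ`
to holomorphic functions, and it vendors as a *named fact*
`Literature.NumberTheory.Transcendental.IsAnalytification.mdifferentiableOn_evalOrZero_opens` the extension of this to *arbitrary*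
opens `U ⊆ X`. This file **discharges that fact**
(`Literature.NumberTheory.Transcendental.IsAnalytification.mdifferentiableOn_evalOrZero_opens_holds`), with no non-Mathlib input.

The argument is the locality step of Serre, GAGA §2: the analytic structure of `X^h` is defined
chart by chart on *any* cover of `X` by Zariski-open sets carrying algebraic charts (n°5, Prop. 2:
uniqueness is «évidente puisque l'on peut recouvrir X par des Z-ouverts V possédant des cartes»,
and the Remarque following it), a function being holomorphic iff it is so near every point
(n°3, Déf. 1 is local); consequently every regular function on a Zariski-open set is holomorphic
(n°5 Lemme 1 (c) for Z-locally-closed subsets of `ℂⁿ`; n°6, «toute fonction régulière est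
holomorphe»). In Lean: `MDifferentiableOn` is a local property
(`mdifferentiableOn_of_locally_mdifferentiableOn`); every point of an open `U` has an affine open
neighbourhood `V ⊆ U` (`AlgebraicGeometry.exists_isAffineOpen_mem_and_subset`); on the open set
`φ⁻¹(V(ℂ))` the pull-back of the restriction `s|_V` is holomorphic by the structure field
`IsAnalytification.mdifferentiableOn_evalOrZero`; and it agrees there with the pull-back of `s`
because evaluation at a point commutes with restriction of sections
(`TopCat.Presheaf.germ_res_apply`), which is the content of the two auxiliary lemmas
`Literature.AlgebraicGeometry.Motives.AlgPoints.eval_map_homOfLE`, `Literature.AlgebraicGeometry.Motives.AlgPoints.evalOrZero_map_homOfLE`.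

## Main statements

* `Literature.AlgebraicGeometry.Motives.AlgPoints.eval_map_homOfLE`, `Literature.AlgebraicGeometry.Motives.AlgPoints.evalOrZero_map_homOfLE` — `(f|_V)(P) = f(P)`
  for an `L`-point `P` with `P ∈ V(L)`, `V ⊆ U`, for `AlgPoints.eval` and its total version
  `AlgPoints.evalOrZero`.
* `Literature.NumberTheory.Transcendental.IsAnalytification.mdifferentiableOn_evalOrZero_opens_holds` — the named fact
  `Literature.NumberTheory.Transcendental.IsAnalytification.mdifferentiableOn_evalOrZero_opens` holds: for an analytification
  `φ : M → X(ℂ)` and any open `U ⊆ X`, `s ∈ Γ(X, U)`, the function `m ↦ s(φ m)` is holomorphic on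
  `φ⁻¹(U(ℂ))`.

## References

* J.-P. Serre, *Géométrie algébrique et géométrie analytique*, Ann. Inst. Fourier **6** (1956),
  1–42, §2 n°5 (Lemme 1, Prop. 2 et Remarque), n°6.
* D. Mumford, *The Red Book of Varieties and Schemes*, I §10.
-/

noncomputable section

universe u

open CategoryTheory AlgebraicGeometry Topology
open scoped Manifold ContDiff

namespace Literature.NumberTheory.Transcendental

/-! ### Evaluation at a point commutes with restriction -/

section AlgPoints
open Literature.AlgebraicGeometry.Motives (AlgPoints)
open Literature.AlgebraicGeometry.Motives.AlgPoints

variable {k : Type u} [Field k] {X : Literature.AlgebraicGeometry.Motives.SchemeOver k} {L : Type u} [Field L] [Algebra k L]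

/-- Evaluation at an `L`-point commutes with restriction of regular functions to a smaller open:
`(f|_V)(P) = f(P)` for `P ∈ V(L)`, `V ⊆ U` (Mathlib `TopCat.Presheaf.germ_res_apply`: the germ
of `f|_V` at `P.pt` is the germ of `f`). [Mumford, *Red Book* I §10] [folklore] -/
theorem _root_.Literature.AlgebraicGeometry.Motives.AlgPoints.eval_map_homOfLE {U V : X.left.Opens} (hVU : V ≤ U) (f : Γ(X.left, U))
    {P : AlgPoints X L} (hV : P.pt ∈ V) :
    P.eval V hV (X.left.presheaf.map (homOfLE hVU).op f) = P.eval U (hVU hV) f := by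
  simp only [AlgPoints.eval, ← Scheme.germ_residue, CategoryTheory.comp_apply]
  congr 1
  exact congrArg (X.left.residue P.pt)
    (TopCat.Presheaf.germ_res_apply X.left.presheaf (homOfLE hVU) P.pt hV f)

/-- The total evaluation `evalOrZero` is compatible with restriction to a smaller open on `V(L)`:
`evalOrZero V (f|_V) P = evalOrZero U f P` for `P.pt ∈ V ⊆ U`.
[Mumford, *Red Book* I §10] [folklore] -/
theorem _root_.Literature.AlgebraicGeometry.Motives.AlgPoints.evalOrZero_map_homOfLE {U V : X.left.Opens} (hVU : V ≤ U) (f : Γ(X.left, U))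
    {P : AlgPoints X L} (hV : P.pt ∈ V) :
    evalOrZero V (X.left.presheaf.map (homOfLE hVU).op f) P = evalOrZero U f P := by
  rw [evalOrZero_of_mem _ hV, evalOrZero_of_mem f (hVU hV), eval_map_homOfLE hVU f hV]

end AlgPoints

/-! ### Regular functions on arbitrary opens are holomorphic -/

namespace IsAnalytification

variable {E : Type*} [NormedAddCommGroup E] [NormedSpace ℂ E] [FiniteDimensional ℂ E]
  {M : Type*} [TopologicalSpace M] [ChartedSpace E M]
  {k : Type} [Field k] [Algebra k ℂ] {X : Literature.AlgebraicGeometry.Motives.SchemeOver k} {d : ℕ} {φ : M → Literature.AlgebraicGeometry.Motives.ComplexPoints X}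

/-- **Regular functions on arbitrary opens are holomorphic on an analytification**
(the named fact `mdifferentiableOn_evalOrZero_opens` holds). Holomorphy is a local property and
`X` is covered by affine opens (Mathlib `exists_isAffineOpen_mem_and_subset`): on an affine open
`V ⊆ U` containing `(φ m).pt`, the restriction `s|_V` pulls back to a holomorphic function (field
`mdifferentiableOn_evalOrZero`), and it agrees with the pull-back of `s` on the open neighbourhood
`φ⁻¹(V(ℂ))` of `m` (`AlgPoints.evalOrZero_map_homOfLE`). This is Serre's observation that the
analytic structure of `X^h` is defined chart by chart on any cover by Zariski-opens carrying
charts, so that every regular function on a Zariski-open set is holomorphic.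
[cite: SerreGAGA1956, §2 n°5 Prop. 2 et Remarque, n°6 («toute fonction régulière est holomorphe»)] -/
theorem mdifferentiableOn_evalOrZero_opens_holds :
    mdifferentiableOn_evalOrZero_opens (E := E) (X := X) (d := d) (φ := φ) := by
  intro hφ U s
  refine mdifferentiableOn_of_locally_mdifferentiableOn fun m hm ↦ ?_
  obtain ⟨V, hVaff, hmV, hVU⟩ := exists_isAffineOpen_mem_and_subset (X := X.left) (U := U) hm
  have hVU' : V ≤ U := hVU
  refine ⟨φ ⁻¹' {P | P.pt ∈ V}, hφ.isOpen_preimage V, hmV, ?_⟩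
  have hsub : φ ⁻¹' {P | P.pt ∈ V} ⊆ φ ⁻¹' {P | P.pt ∈ U} := fun m' hm' ↦ hVU' hm'
  rw [Set.inter_eq_right.mpr hsub]
  exact (hφ.mdifferentiableOn_evalOrZero ⟨V, hVaff⟩
    (X.left.presheaf.map (homOfLE hVU').op s)).congr
      fun m' hm' ↦ (Literature.AlgebraicGeometry.Motives.AlgPoints.evalOrZero_map_homOfLE hVU' s hm').symm

end IsAnalytification

end Literature.NumberTheory.Transcendental
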